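import Literature.MathematicalPhysics.QuantumFieldTheory.Balaban1983to89.B13ChainWalkDecoration

/-!
# `Balaban1983to89.B13DecorationAlgebra` — T. Bałaban, *Renormalization group approach to lattice gauge field theories.
II. Cluster expansions*, Commun. Math. Phys. **116** (1988) 1–22 [Balaban1988RG2Cluster], (1.11) p. 5, p. 13, with [13]
= [Balaban1985BackgroundPropagators] (3.93) p. 410, Thm 3.12 p. 423 *"we replace each operator … by its random walk
expansion"*: THE (1.11) DECORATION GEOMETRY IS COMPOSITIONAL — the AFFINE absorption `κ₁|J(ω)| ≤ κ₁m₀ + η·D_ω(a,b)`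
(the binder `habs` of `B13Eq111SDecoupling.jointWalkExpansion_sDecorate`) and the through-clause (a walk picking up a
parameter passes through `X`) are preserved by every operation of the tree's walk calculus: SUMS (decoration on
`W₁ ⊕ W₂`), PRODUCTS (union of the factors' cubes, concatenated distance `D₁ □ D₂`, constants `m₁ + m₂`), TRANSPOSITION
(distance read backwards), SCALARS ∕ SUB-BLOCKS (nothing changes), and the NEUMANN CHAINS of `B13JointWalkExpansionNeumann`
with a per-step penalty (seed's absorption + `≤ n_K` cubes per step, `κ₁n_K ≤ ηs`) — so that the decoration data of a
kernel assembled from walk-expanded pieces by `B13JointWalkExpansionAlgebra` ∕ `B13JointWalkExpansionNeumann` is assembled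
BY NAME from the pieces'

statement-level bookkeeping over published theorems with citation tags; kernel-checked; nothing here is a claim about the
Yang–Mills mass gap.

WHY (cell `pub-ymgap`, D-0062 Track A, node N10 = [B13]; seat `pub-ymgap-dag-n10-c` g4, module 29; census v4 class A2″).
Module 28 (`B13ChainWalkDecoration`) delivered the junction's `hKexp` datum from one-step factor data for ONE resolvent
`G₀(1 − R)⁻¹`; the fluctuation operator `Δ_k(𝐔,𝐉)` is a finite sum ∕ product of such resolvents and local operators ([I]
§1–2).  Its σ-free expansion is assembled by type-B13's algebra; THIS FILE assembles the matching decoration: for each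
operation, the cube map `J`, the constant `m₀` and the through-clause of the result from those of the arguments, in the
affine form that `structuredExpansion_sandwich_sDecorate_symm_abs` (module 28) consumes.

WHAT THIS FILE PROVES (all `theorem`s; no `def`, no instance, no notation; geometry = the one-scale ℓ¹ site torus).
§1 SUM: `absorb_sum`, `through_sum` (decoration `Sum.elim J₁ J₂`, distances `Sum.elim D₁ D₂`, constant `max`-free: any
   common `m₀ ≥ m₁, m₂`).
§2 PRODUCT: `card_union_le_add`, ★ `absorb_mul` (`J(ω₁,ω₂) = J₁ω₁ ∪ J₂ω₂`, `D = D₁ω₁ □ D₂ω₂`, `m₀ = m₁ + m₂` — the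
   absorption of each factor is read at the minimising junction point of (3.93)), `through_mul` (a product picking up a
   parameter passes through `X` because one factor does; the other dominates `d₁`).
§3 ONE-FACTOR OPERATIONS: `absorb_transpose` ∕ `through_transpose` (distance read backwards; symmetry of `d₁`) — scalars and
   sub-blocks change neither `J` nor `D`.
§4 NEUMANN CHAINS: ★ `absorb_neumannChain` — steps with `≤ n_K` cubes each, seed with the affine absorption
   `κ₁|J_C ω| ≤ κ₁m_C + ηD_C,ω`, step distances dominating `d₁` and shifted by the penalty `s` (`κ₁n_K ≤ ηs`, `η ≥ 0`) ⟹ the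
   chain decoration `J(l,ω) = ⋃ J_K(i) ∪ J_C(ω)` satisfies `κ₁|J(l,ω)| ≤ κ₁m_C + η·chainDist (D_K + s) D_C,ω l` (module 28's
   `absorb_chain` is the case of a seed counted by pieces); `through_neumannChain`.
HONEST FRAMING: pure bookkeeping (finite sets, the (3.93) infimum on a finite torus) over HYPOTHESIS data; on Bałaban's
carriers the cube maps are the σ₀-cubes met by [13]'s localization domains and the counting letters are (1.33)'s geometry
(`B13WalkCubes111`) — INPUTS here; NOTHING of Bałaban's is constructed or asserted; (D4) ∕ NODE A NOT discharged;
count-neutral; NOT a discharge of N10; no `sorry`, no new named fact; standard axioms; nothing continuum ∕ ℝ⁴ ∕ OS ∕ mass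
gap ∕ Clay.
-/

noncomputable section

namespace Literature.MathematicalPhysics.QuantumFieldTheory.Balaban1983to89.B13DecorationAlgebra

open Metric Set Finset
open Literature.MathematicalPhysics.QuantumFieldTheory.Balaban1983to89
open Literature.MathematicalPhysics.QuantumFieldTheory.Balaban1983to89.B9SectDWalk
  (Through DomBy infConv chainDist domBy_chainDist through_chainDist_seed through_chainDist_mem infConv_le
    exists_infConv_eq le_infConv domBy_infConv through_infConv_left through_infConv_right)
open Literature.MathematicalPhysics.QuantumFieldTheory.Balaban1983to89.B9Thm34Ext (toB6)
open Literature.MathematicalPhysics.QuantumFieldTheory.Balaban1983to89.B9Thm37GlueTorus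
  (torusGeom tdist1 tdist1_nonneg tdist1_comm hdnn_torusGeom htri_torusGeom)
open Literature.MathematicalPhysics.QuantumFieldTheory.Balaban1983to89.TreeLengthTorus (TPt)
open Literature.MathematicalPhysics.QuantumFieldTheory.Balaban1983to89.B5TorusCover (UT)
open Literature.MathematicalPhysics.QuantumFieldTheory.Balaban1983to89.B13ChainWalkDecoration
  (card_chainCubes_le chainCubes_nonempty chainDist_shift)

variable {ν : ℕ} {Nf : Fin ν → ℕ} [∀ i, NeZero (Nf i)]
variable {ι' : Type} [DecidableEq ι']

/-! ## §1. Sums -/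

section Sum

variable {W₁ W₂ : Type} {J₁ : W₁ → Finset ι'} {J₂ : W₂ → Finset ι'}
variable {D₁ : W₁ → UT Nf → UT Nf → ℝ} {D₂ : W₂ → UT Nf → UT Nf → ℝ} {κ₁ η : ℝ} {m₁ m₂ m₀ : ℕ} {X : Finset (UT Nf)}

omit [∀ i, NeZero (Nf i)] [DecidableEq ι'] in
/-- **SUM**: the absorption of a sum family is that of its summands (at any common constant `m₀ ≥ m₁, m₂`; `κ₁ ≥ 0`).
[cite: Balaban1988RG2Cluster, (1.11) p.5, (2.5) p.12] -/
theorem absorb_sum (hκ₁ : 0 ≤ κ₁) (hm₁ : m₁ ≤ m₀) (hm₂ : m₂ ≤ m₀)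
    (h₁ : ∀ ω a b, κ₁ * (J₁ ω).card ≤ κ₁ * m₁ + η * D₁ ω a b)
    (h₂ : ∀ ω a b, κ₁ * (J₂ ω).card ≤ κ₁ * m₂ + η * D₂ ω a b) :
    ∀ (ω : W₁ ⊕ W₂) a b, κ₁ * (Sum.elim J₁ J₂ ω).card ≤ κ₁ * m₀ + η * Sum.elim D₁ D₂ ω a b := by
  have hm₁' : (m₁ : ℝ) ≤ m₀ := by exact_mod_cast hm₁
  have hm₂' : (m₂ : ℝ) ≤ m₀ := by exact_mod_cast hm₂
  rintro (ω | ω) a b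
  · have h := h₁ ω a b
    simp only [Sum.elim_inl]
    nlinarith [mul_le_mul_of_nonneg_left hm₁' hκ₁]
  · have h := h₂ ω a b
    simp only [Sum.elim_inr]
    nlinarith [mul_le_mul_of_nonneg_left hm₂' hκ₁]

omit [DecidableEq ι'] in
/-- **SUM**: the through-clause of a sum family is that of its summands. [cite: Balaban1988RG2Cluster, p.13] -/
theorem through_sum
    (h₁ : ∀ ω, (J₁ ω).Nonempty → Through (toB6 (torusGeom Nf 0 0 0) 0 True) (D₁ ω) (↑X : Set (UT Nf)))
    (h₂ : ∀ ω, (J₂ ω).Nonempty → Through (toB6 (torusGeom Nf 0 0 0) 0 True) (D₂ ω) (↑X : Set (UT Nf))) :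
    ∀ ω : W₁ ⊕ W₂, (Sum.elim J₁ J₂ ω).Nonempty →
      Through (toB6 (torusGeom Nf 0 0 0) 0 True) (Sum.elim D₁ D₂ ω) (↑X : Set (UT Nf)) := by
  rintro (ω | ω) hω
  · exact h₁ ω hω
  · exact h₂ ω hω

end Sum

/-! ## §2. Products -/

section Mul

variable {W₁ W₂ : Type} {J₁ : W₁ → Finset ι'} {J₂ : W₂ → Finset ι'}
variable {D₁ : W₁ → UT Nf → UT Nf → ℝ} {D₂ : W₂ → UT Nf → UT Nf → ℝ} {κ₁ η : ℝ} {m₁ m₂ : ℕ} {X : Finset (UT Nf)}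

omit [∀ i, NeZero (Nf i)] in
/-- The cube count of a union is at most the sum of the counts. [folklore] -/
private theorem card_union_le_add (s t : Finset ι') : ((s ∪ t).card : ℝ) ≤ s.card + t.card := by
  exact_mod_cast Finset.card_union_le s t

/-- **PRODUCT** ([13] Thm 3.12: each operator replaced by its expansion; the cubes of a product term are the cubes of its
two factors): with `J(ω₁,ω₂) = J₁ω₁ ∪ J₂ω₂` and the concatenated distance `D₁ω₁ □ D₂ω₂` of (3.93), the affine absorptions
of the factors add up — `κ₁|J| ≤ κ₁(m₁ + m₂) + η·(D₁ □ D₂)(a,b)`, each factor read at the minimising junction point.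
[cite: Balaban1988RG2Cluster, (1.11) p.5, p.13; Balaban1985BackgroundPropagators, (3.93) p.410, Thm 3.12 p.423] -/
theorem absorb_mul
    (h₁ : ∀ ω a b, κ₁ * (J₁ ω).card ≤ κ₁ * m₁ + η * D₁ ω a b)
    (h₂ : ∀ ω a b, κ₁ * (J₂ ω).card ≤ κ₁ * m₂ + η * D₂ ω a b) (hκ₁ : 0 ≤ κ₁) :
    ∀ (ω : W₁ × W₂) a b, κ₁ * (J₁ ω.1 ∪ J₂ ω.2).card ≤
      κ₁ * (m₁ + m₂ : ℕ) + η * infConv (g := toB6 (torusGeom Nf 0 0 0) 0 True) (D₁ ω.1) (D₂ ω.2) a b := by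
  intro ω a b
  obtain ⟨y, hy⟩ := exists_infConv_eq (g := toB6 (torusGeom Nf 0 0 0) 0 True) (D₁ ω.1) (D₂ ω.2) a b
  have hu := card_union_le_add (J₁ ω.1) (J₂ ω.2)
  have e1 := h₁ ω.1 a y
  have e2 := h₂ ω.2 y b
  rw [hy, Nat.cast_add]
  nlinarith [mul_le_mul_of_nonneg_left hu hκ₁]

/-- **PRODUCT**: a product term picking up a parameter passes through `X` — one factor picks it up and passes through
`X`, the other dominates `d₁` (`through_infConv_left ∕ _right`). [cite: Balaban1985BackgroundPropagators, (3.93) p.410; Balaban1988RG2Cluster, p.13] -/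
theorem through_mul
    (hd₁ : ∀ ω, DomBy (toB6 (torusGeom Nf 0 0 0) 0 True) (D₁ ω)) (hd₂ : ∀ ω, DomBy (toB6 (torusGeom Nf 0 0 0) 0 True) (D₂ ω))
    (h₁ : ∀ ω, (J₁ ω).Nonempty → Through (toB6 (torusGeom Nf 0 0 0) 0 True) (D₁ ω) (↑X : Set (UT Nf)))
    (h₂ : ∀ ω, (J₂ ω).Nonempty → Through (toB6 (torusGeom Nf 0 0 0) 0 True) (D₂ ω) (↑X : Set (UT Nf))) :
    ∀ ω : W₁ × W₂, (J₁ ω.1 ∪ J₂ ω.2).Nonempty →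
      Through (toB6 (torusGeom Nf 0 0 0) 0 True)
        (infConv (g := toB6 (torusGeom Nf 0 0 0) 0 True) (D₁ ω.1) (D₂ ω.2)) (↑X : Set (UT Nf)) := by
  intro ω hω
  rcases Finset.union_nonempty.1 hω with h | h
  · exact through_infConv_left (htri_torusGeom 0 0 0 0 True) (h₁ ω.1 h) (hd₂ ω.2)
  · exact through_infConv_right (htri_torusGeom 0 0 0 0 True) (hd₁ ω.1) (h₂ ω.2 h)

end Mul

/-! ## §3. Transposition (distance read backwards); scalars and sub-blocks change nothing -/

section Transpose

variable {W : Type} {J : W → Finset ι'} {D : W → UT Nf → UT Nf → ℝ} {κ₁ η : ℝ} {m₀ : ℕ} {X : Finset (UT Nf)}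

omit [∀ i, NeZero (Nf i)] [DecidableEq ι'] in
/-- **TRANSPOSITION**: the absorption survives reading the distance backwards (it holds for every pair of endpoints).
[cite: Balaban1985BackgroundPropagators, (3.107) p.416] -/
theorem absorb_transpose (h : ∀ ω a b, κ₁ * (J ω).card ≤ κ₁ * m₀ + η * D ω a b) :
    ∀ ω a b, κ₁ * (J ω).card ≤ κ₁ * m₀ + η * (fun ω a b => D ω b a) ω a b := fun ω a b => h ω b a

omit [DecidableEq ι'] in
/-- **TRANSPOSITION**: the through-clause survives reading the distance backwards (symmetry of `d₁`; module 25's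
`through_symmetrize`). [cite: Balaban1985BackgroundPropagators, (3.93) p.410] -/
theorem through_transpose (h : ∀ ω, (J ω).Nonempty → Through (toB6 (torusGeom Nf 0 0 0) 0 True) (D ω) (↑X : Set (UT Nf))) :
    ∀ ω, (J ω).Nonempty → Through (toB6 (torusGeom Nf 0 0 0) 0 True) (fun a b => D ω b a) (↑X : Set (UT Nf)) :=
  fun ω hω => B13JointWalkExpansionSymmetrize.through_symmetrize (h ω hω)

end Transpose

/-! ## §4. Neumann chains with a per-step penalty -/

section Chains

variable {WK WC : Type} {JK : WK → Finset ι'} {JC : WC → Finset ι'}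
variable {DK : WK → UT Nf → UT Nf → ℝ} {DC : WC → UT Nf → UT Nf → ℝ} {κ₁ η s : ℝ} {nK mC : ℕ} {X : Finset (UT Nf)}

omit [∀ i, NeZero (Nf i)] in
/-- The cube count of a chain over a seed: `|⋃ J_K(i) ∪ J_C(ω)| ≤ n_K·|l| + |J_C(ω)|`. [cite: Balaban1988RG2Cluster, (1.11) p.5] -/
theorem card_chainCubes_le_add (hK : ∀ i, (JK i).card ≤ nK) :
    ∀ (l : List WK) (ω : WC), ((l.foldr (fun i S => JK i ∪ S) (JC ω)).card : ℝ) ≤ nK * l.length + (JC ω).card := by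
  intro l ω
  induction l with
  | nil => simp
  | cons i l ih =>
      simp only [List.foldr_cons, List.length_cons, Nat.cast_succ]
      have hu : ((JK i ∪ List.foldr (fun i S => JK i ∪ S) (JC ω) l).card : ℝ) ≤
          (JK i).card + (List.foldr (fun i S => JK i ∪ S) (JC ω) l).card := by
        exact_mod_cast Finset.card_union_le _ _
      have hi : ((JK i).card : ℝ) ≤ nK := by exact_mod_cast hK i
      nlinarith

/-- **NEUMANN CHAINS** ([13] (3.106)∕(3.130) with [II] (1.11)): steps meeting `≤ n_K` cubes each, with walk distances
dominating `d₁` and SHIFTED by the penalty `s` (`B13ChainWalkDecoration.jointWalkExpansion_shiftDist`), a seed with the affine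
absorption `κ₁|J_C ω| ≤ κ₁m_C + η·D_C,ω(a,b)`, `η ≥ 0`, `κ₁n_K ≤ ηs` ⟹ the chain decoration satisfies
`κ₁|J(l,ω)| ≤ κ₁m_C + η·chainDist (D_K + s) D_C,ω l (a,b)` — every step's cubes are paid by its penalty, the seed's by
its own absorption read at the last junction point. [cite: Balaban1988RG2Cluster, (1.11) p.5, p.13; Balaban1985BackgroundPropagators, (3.93) p.410, (3.106) p.414, (3.108) p.416] -/
theorem absorb_neumannChain (hK : ∀ i, (JK i).card ≤ nK)
    (hC : ∀ ω a b, κ₁ * (JC ω).card ≤ κ₁ * mC + η * DC ω a b)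
    (hKdom : ∀ i, DomBy (toB6 (torusGeom Nf 0 0 0) 0 True) (DK i))
    (hκ₁ : 0 ≤ κ₁) (hη : 0 ≤ η) (hs : κ₁ * nK ≤ η * s) :
    ∀ (p : List WK × WC) a b, κ₁ * ((p.1.foldr (fun i S => JK i ∪ S) (JC p.2)).card : ℝ) ≤
      κ₁ * mC + η * chainDist (g := toB6 (torusGeom Nf 0 0 0) 0 True) (fun i a b => DK i a b + s) (DC p.2) p.1 a b := by
  -- the chain distance of shifted steps dominates `s|l| + D_C(y, b)` for SOME junction point `y`
  have key : ∀ (l : List WK) (ω : WC) (a b : UT Nf), ∃ y : UT Nf,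
      s * l.length + DC ω y b ≤ chainDist (g := toB6 (torusGeom Nf 0 0 0) 0 True) (fun i a b => DK i a b + s) (DC ω) l a b := by
    intro l ω
    induction l with
    | nil => intro a b; exact ⟨a, by simp⟩
    | cons i l ih =>
        intro a b
        simp only [B9SectDWalk.chainDist_cons, List.length_cons, Nat.cast_succ]
        obtain ⟨y'', hy''⟩ := exists_infConv_eq (g := toB6 (torusGeom Nf 0 0 0) 0 True) (fun a b => DK i a b + s)
          (chainDist (g := toB6 (torusGeom Nf 0 0 0) 0 True) (fun i a b => DK i a b + s) (DC ω) l) a b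
        obtain ⟨y, hy⟩ := ih y'' b
        refine ⟨y, ?_⟩
        rw [hy'']
        have hD : 0 ≤ DK i a y'' := (hdnn_torusGeom 0 0 0 a y'').trans (hKdom i a y'')
        nlinarith
  intro p a b
  obtain ⟨y, hy⟩ := key p.1 p.2 a b
  have hcard := card_chainCubes_le_add (JC := JC) hK p.1 p.2
  have hseed := hC p.2 y b
  have hlen : (0 : ℝ) ≤ p.1.length := Nat.cast_nonneg _
  have h1 : κ₁ * ((p.1.foldr (fun i S => JK i ∪ S) (JC p.2)).card : ℝ) ≤ κ₁ * (nK * p.1.length + (JC p.2).card) :=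
    mul_le_mul_of_nonneg_left hcard hκ₁
  have h2 : κ₁ * nK * (p.1.length : ℝ) ≤ η * s * p.1.length := mul_le_mul_of_nonneg_right hs hlen
  nlinarith [mul_le_mul_of_nonneg_left hy hη]

/-- **NEUMANN CHAINS**: the through-clause of the chain decoration from the steps' and the seed's (module 28's
`through_chainCubes`, read for the shifted step distances). [cite: Balaban1985BackgroundPropagators, (3.93) p.410, Thm 3.10 p.416; Balaban1988RG2Cluster, p.13] -/
theorem through_neumannChain
    (hKdom : ∀ i, DomBy (toB6 (torusGeom Nf 0 0 0) 0 True) (DK i))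
    (hCdom : ∀ ω, DomBy (toB6 (torusGeom Nf 0 0 0) 0 True) (DC ω))
    (hKX : ∀ i, (JK i).Nonempty → Through (toB6 (torusGeom Nf 0 0 0) 0 True) (DK i) (↑X : Set (UT Nf)))
    (hCX : ∀ ω, (JC ω).Nonempty → Through (toB6 (torusGeom Nf 0 0 0) 0 True) (DC ω) (↑X : Set (UT Nf)))
    (hs : 0 ≤ s) :
    ∀ p : List WK × WC, (p.1.foldr (fun i S => JK i ∪ S) (JC p.2)).Nonempty →
      Through (toB6 (torusGeom Nf 0 0 0) 0 True)
        (chainDist (g := toB6 (torusGeom Nf 0 0 0) 0 True) (fun i a b => DK i a b + s) (DC p.2) p.1) (↑X : Set (UT Nf)) := by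
  intro p hp
  have hKdom' : ∀ i, DomBy (toB6 (torusGeom Nf 0 0 0) 0 True) (fun a b => DK i a b + s) :=
    fun i => B13ChainWalkDecoration.domBy_shift (hKdom i) hs
  have hKX' : ∀ i, (JK i).Nonempty → Through (toB6 (torusGeom Nf 0 0 0) 0 True) (fun a b => DK i a b + s) (↑X : Set (UT Nf)) := by
    intro i hi y y'
    obtain ⟨z, hz, hle⟩ := hKX i hi y y'
    exact ⟨z, hz, hle.trans (le_add_of_nonneg_right hs)⟩
  rcases chainCubes_nonempty JK JC p.1 p.2 hp with hseed | ⟨i, hi, hstep⟩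
  · exact through_chainDist_seed (htri_torusGeom 0 0 0 0 True) hKdom' (hCX p.2 hseed) p.1
  · exact through_chainDist_mem (htri_torusGeom 0 0 0 0 True) hKdom' (hCdom p.2) (hKX' i hstep) p.1 hi

end Chains

end Literature.MathematicalPhysics.QuantumFieldTheory.Balaban1983to89.B13DecorationAlgebra

end
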